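import Summits.PneNP.PneNP.Theorems.RamseyUncertifiableSosUncertaintyDefs
import Mathlib

/-!
# Route RamseyUncertifiable, crux `SosUncertainty` (stmt-PneNP-9815), line `hadamard-bessel-defect`:
the Hadamard–Bessel inequality (registered stub `stub_hadamardBessel`)

For nonnegative weights `w, w'` on `Fin n` and ANY pair of level-`t` SoS certificates `Q` for
`(G, w)` and `Q'` for `(Gᶜ, w')` (`IsCertificate`, vocabulary of
`Summits.PneNP.PneNP.Theorems.RamseyUncertifiableSosUncertaintyDefs`),

  `Σ_v w_v w'_v ≤ λ_max(cosMatrix Q ⊙ cosMatrix Q')`,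

with "`λ_max ≤ M`" written as `M • 1 − cosMatrix Q ⊙ cosMatrix Q' ⪰ 0`. This is the engine of
the line: at near-canonical constant weights it turns a defect bound `λ_max ≤ n^γ` into
`n · a · b ≤ n^γ`.

Proof (no Gram vectors, no Kronecker products):

1. From the certificate equations, `Q_∅∅ = 1` and `2 Q_{∅v} + Q_{vv} = −w_v`; by AM–GM
   `w_v ≤ c_v²` with `c_v := Q_{∅v} / √Q_{vv}` (`c_v := 0` when `Q_{vv} = 0`, where the whole
   column vanishes by `psd_apply_eq_zero_of_diag_eq_zero`).
2. `cosMatrix Q − c cᵀ ⪰ 0`: test `Q ⪰ 0` (restricted to `∅` and the singletons, an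
   `Option V`-indexed principal submatrix) on the vector `(−⟨c, y⟩, (y_v/√Q_vv)_v)`.
3. Schur-product monotonicity with `d := c ⊙ c'`:
   `C ⊙ C' − d dᵀ = (C − ccᵀ) ⊙ C' + ccᵀ ⊙ (C' − c'c'ᵀ) ⪰ 0` by Mathlib's Schur product theorem
   `Matrix.PosSemidef.hadamard`; adding the hypothesis, `M • 1 − d dᵀ ⪰ 0`.
4. Testing on `d`: `‖d‖² (M − ‖d‖²) ≥ 0`, so `Σ_v w_v w'_v ≤ Σ_v c_v² c'_v² = ‖d‖² ≤ M`
   (`0 ≤ M` covers `d = 0`). At level `t = 0` the certificate forces `w = 0` and everything is `0`.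

Only the fields `posSemidef`, `empty`, `singleton` of the certificates are used; the graphs play no
role. Only Mathlib and the Defs module are used; no named fact is assumed. [folklore]
-/

namespace Summit.PneNP.PneNP.Cruxes.SosUncertainty.HadamardBesselDefect

open Finset Matrix Literature.Combinatorics.SimpleGraph

set_option linter.dupNamespace false -- `Summit.PneNP.PneNP.…`: summit = sub-problem name (D-0017)

variable {V : Type*} [Fintype V] [DecidableEq V]

/-- The constant coefficient of a certificate, read at an index `e` with `e.1 = ∅`:
`Q_∅∅ = unionSum Q ∅ = 1` (the only pair `(I, J)` with `I ∪ J = ∅` is `(∅, ∅)`). [folklore] -/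
private theorem cert_apply_empty {G : SimpleGraph V} {t : ℕ} {w : V → ℝ}
    {Q : Matrix (Idx V t) (Idx V t) ℝ} (hQ : IsCertificate G t w Q)
    (e : Idx V t) (he : e.1 = ∅) : Q e e = 1 := by
  have h : unionSum Q ∅ = Q e e := by
    unfold unionSum
    rw [Fintype.sum_eq_single e, Fintype.sum_eq_single e]
    · simp [he]
    · intro J hJ
      rw [if_neg]
      intro hU
      exact hJ (Subtype.ext ((Finset.union_eq_empty.1 hU).2.trans he.symm))
    · intro I hI
      refine Finset.sum_eq_zero fun J _ => ?_
      rw [if_neg]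
      intro hU
      exact hI (Subtype.ext ((Finset.union_eq_empty.1 hU).1.trans he.symm))
  rw [← h]
  exact hQ.empty

/-- The `x_v`-coefficient of a certificate at level `t ≥ 1`: `2 Q_{∅,{v}} + Q_{{v},{v}} = −w_v`
(the pairs `(I, J)` with `I ∪ J = {v}` are `(∅,{v})`, `({v},∅)`, `({v},{v})`, and `Q` is
symmetric). [folklore] -/
private theorem cert_singleton_entries {G : SimpleGraph V} {t : ℕ} {w : V → ℝ}
    {Q : Matrix (Idx V t) (Idx V t) ℝ} (hQ : IsCertificate G t w Q)
    (e : Idx V t) (he : e.1 = ∅) (ht : 1 ≤ t) (v : V) :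
    2 * Q e (vtx t ht v) + Q (vtx t ht v) (vtx t ht v) = -w v := by
  set x : Idx V t := vtx t ht v with hxdef
  have hx : x.1 = {v} := rfl
  have hsymm : Q x e = Q e x := by
    have h := hQ.posSemidef.isHermitian.apply e x
    rwa [star_trivial] at h
  have hex : e ≠ x := by
    intro h
    have h1 : e.1 = x.1 := congrArg Subtype.val h
    rw [he, hx] at h1
    exact Finset.singleton_ne_empty v h1.symm
  have hmem : ∀ I : Idx V t, I.1 ⊆ {v} → I = e ∨ I = x := by
    intro I hI
    rcases Finset.subset_singleton_iff.1 hI with h | h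
    · exact Or.inl (Subtype.ext (h.trans he.symm))
    · exact Or.inr (Subtype.ext (h.trans hx.symm))
  have hval : ∀ I J : Idx V t, I.1 ∪ J.1 = {v} → (I = e ∨ I = x) ∧ (J = e ∨ J = x) :=
    fun I J h =>
      ⟨hmem I (by rw [← h]; exact Finset.subset_union_left),
        hmem J (by rw [← h]; exact Finset.subset_union_right)⟩
  have key : unionSum Q {v} = Q e x + (Q x e + Q x x) := by
    unfold unionSum
    rw [Fintype.sum_eq_add e x hex]
    · congr 1
      · rw [Fintype.sum_eq_single x]
        · simp [he, hx]
        · intro J hJ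
          rw [if_neg]
          intro hU
          rcases (hval e J hU).2 with h | h
          · rw [h, he, Finset.union_self] at hU
            exact Finset.singleton_ne_empty v hU.symm
          · exact hJ h
      · rw [Fintype.sum_eq_add e x hex]
        · simp [he, hx]
        · rintro J ⟨hJe, hJx⟩
          rw [if_neg]
          intro hU
          rcases (hval x J hU).2 with h | h
          exacts [hJe h, hJx h]
    · rintro I ⟨hIe, hIx⟩
      refine Finset.sum_eq_zero fun J _ => ?_
      rw [if_neg]
      intro hU
      rcases (hval I J hU).1 with h | h
      exacts [hIe h, hIx h]
  have h := hQ.singleton v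
  rw [key, hsymm] at h
  linarith

/-- **Bessel vector of a certificate.** For every level-`t` certificate `Q` of `(G, w)` there is
`c : V → ℝ` (namely `c_v = Q_{∅v} / √Q_{vv}`, and `c = 0` at level `0`) with
`w_v ≤ c_v²` for all `v` (AM–GM on `2 Q_{∅v} + Q_{vv} = −w_v`) and
`cosMatrix Q − c cᵀ ⪰ 0` (test `Q ⪰ 0` on vectors supported on `∅` and the singletons: the
Schur complement of the `∅`-row of the normalised singleton block). With Gram vectors
`r_S` of `Q` this is Bessel's inequality for the unit vector `r_∅` against the directions
`r_v/‖r_v‖`, in matrix form. [folklore] -/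
theorem IsCertificate.exists_sq_bound_cosMatrix_sub_posSemidef {G : SimpleGraph V} {t : ℕ}
    {w : V → ℝ} {Q : Matrix (Idx V t) (Idx V t) ℝ} (hQ : IsCertificate G t w Q) :
    ∃ c : V → ℝ, (∀ v, w v ≤ c v ^ 2) ∧ (cosMatrix Q - vecMulVec c c).PosSemidef := by
  by_cases ht : 1 ≤ t
  swap
  · -- level `0`: the certificate forces `w = 0`, and `cosMatrix Q = 0`
    have hw : ∀ v, w v = 0 := by
      intro v
      have h0 : unionSum Q ({v} : Finset V) = 0 :=
        unionSum_eq_zero_of_card_lt Q (by rw [Finset.card_singleton]; omega)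
      have h := hQ.singleton v
      rw [h0] at h
      linarith
    have hC : cosMatrix Q - vecMulVec (0 : V → ℝ) 0 = 0 := by
      ext u v
      simp [cosMatrix, vtxEntry, ht]
    refine ⟨0, fun v => by simp [hw v], ?_⟩
    rw [hC]
    exact PosSemidef.zero
  -- level `≥ 1`
  obtain ⟨e, he⟩ : ∃ e : Idx V t, e.1 = ∅ := ⟨⟨∅, by simp⟩, rfl⟩
  set x : V → Idx V t := vtx t ht with hxdef
  have hsymm : ∀ I J, Q J I = Q I J := fun I J => by
    have h := hQ.posSemidef.isHermitian.apply I J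
    rwa [star_trivial] at h
  have hE : Q e e = 1 := cert_apply_empty hQ e he
  have hS : ∀ v, 2 * Q e (x v) + Q (x v) (x v) = -w v :=
    fun v => cert_singleton_entries hQ e he ht v
  have hdiag : ∀ v, 0 ≤ Q (x v) (x v) := fun v => hQ.posSemidef.diag_nonneg
  have hzero : ∀ v, Q (x v) (x v) = 0 → ∀ I, Q I (x v) = 0 :=
    fun v hv I => psd_apply_eq_zero_of_diag_eq_zero hQ.posSemidef hv I
  have hve : ∀ u v, vtxEntry Q u v = Q (x u) (x v) := fun u v => dif_pos ht
  -- the normalising scalars `s_v = 1/√Q_vv` (`= 0` when `Q_vv = 0`)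
  obtain ⟨s, hs⟩ : ∃ s : V → ℝ, ∀ v, s v = (Real.sqrt (Q (x v) (x v)))⁻¹ := ⟨_, fun v => rfl⟩
  have hCuv : ∀ u v, cosMatrix Q u v = s u * Q (x u) (x v) * s v := by
    intro u v
    simp only [cosMatrix, Matrix.of_apply, hve, hs]
    rw [div_eq_mul_inv, mul_inv]
    ring
  obtain ⟨c, hc⟩ : ∃ c : V → ℝ, ∀ v, c v = s v * Q e (x v) := ⟨_, fun v => rfl⟩
  refine ⟨c, fun v => ?_, ?_⟩
  · -- AM–GM: `w_v = −2p − q ≤ p²/q`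
    rcases (hdiag v).eq_or_lt with hq | hq
    · have hp : Q e (x v) = 0 := hzero v hq.symm e
      have h := hS v
      rw [hp, ← hq] at h
      rw [hc, hp]
      nlinarith [h]
    · have hsq : s v ^ 2 * Q (x v) (x v) = 1 := by
        rw [hs, inv_pow, Real.sq_sqrt hq.le, inv_mul_cancel₀ hq.ne']
      have hkey : c v ^ 2 * Q (x v) (x v) = Q e (x v) ^ 2 := by
        calc c v ^ 2 * Q (x v) (x v) = (s v ^ 2 * Q (x v) (x v)) * Q e (x v) ^ 2 := by
              rw [hc]; ring
          _ = Q e (x v) ^ 2 := by rw [hsq, one_mul]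
      have hw : w v = -(2 * Q e (x v) + Q (x v) (x v)) := by linarith [hS v]
      refine le_of_mul_le_mul_right ?_ hq
      rw [hkey, hw]
      nlinarith [sq_nonneg (Q e (x v) + Q (x v) (x v))]
  · -- the Schur complement: `yᵀ (C − c cᵀ) y = zᵀ P z ≥ 0` for `P = Q|_{∅, singletons}`
    obtain ⟨emb, hemb0, hemb1⟩ : ∃ emb : Option V → Idx V t,
        emb none = e ∧ ∀ v, emb (some v) = x v := ⟨fun o => o.elim e x, rfl, fun v => rfl⟩
    have hP : (Q.submatrix emb emb).PosSemidef := hQ.posSemidef.submatrix emb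
    refine PosSemidef.of_dotProduct_mulVec_nonneg ?_ fun y => ?_
    · refine Matrix.IsHermitian.ext fun i j => ?_
      rw [star_trivial, Matrix.sub_apply, Matrix.sub_apply, vecMulVec_apply, vecMulVec_apply, hCuv, hCuv,
        hsymm (x i) (x j)]
      ring
    · obtain ⟨z, hz0, hz1⟩ : ∃ z : Option V → ℝ,
          z none = -(∑ v, c v * y v) ∧ ∀ v, z (some v) = s v * y v :=
        ⟨fun o => o.elim (-(∑ v, c v * y v)) (fun v => s v * y v), rfl, fun v => rfl⟩
      have hz := hP.dotProduct_mulVec_nonneg z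
      have hβ : ∑ v, Q e (x v) * z (some v) = ∑ v, c v * y v :=
        Finset.sum_congr rfl fun v _ => by rw [hz1, hc]; ring
      have hin : ∀ u, z (some u) * (Q (x u) e * z none + ∑ v, Q (x u) (x v) * z (some v))
          = -(∑ v, c v * y v) * (c u * y u)
            + ∑ v, y u * (s u * Q (x u) (x v) * s v) * y v := by
        intro u
        rw [mul_add, Finset.mul_sum, hz1, hz0, hsymm e (x u), hc]
        congr 1
        · ring
        · exact Finset.sum_congr rfl fun v _ => by rw [hz1]; ring
      have hQform : star z ⬝ᵥ (Q.submatrix emb emb *ᵥ z)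
          = (∑ u, ∑ v, y u * (s u * Q (x u) (x v) * s v) * y v) - (∑ v, c v * y v) ^ 2 := by
        calc star z ⬝ᵥ (Q.submatrix emb emb *ᵥ z)
            = z none * (Q e e * z none + ∑ v, Q e (x v) * z (some v))
              + ∑ u, z (some u) * (Q (x u) e * z none + ∑ v, Q (x u) (x v) * z (some v)) := by
              simp only [dotProduct, mulVec, submatrix_apply, star_trivial, Fintype.sum_option,
                hemb0, hemb1]
          _ = (∑ u, ∑ v, y u * (s u * Q (x u) (x v) * s v) * y v) - (∑ v, c v * y v) ^ 2 := by
              rw [hE, hβ, Finset.sum_congr rfl fun u _ => hin u, Finset.sum_add_distrib,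
                ← Finset.mul_sum, hz0]
              ring
      have hCform : star y ⬝ᵥ ((cosMatrix Q - vecMulVec c c) *ᵥ y)
          = (∑ u, ∑ v, y u * (s u * Q (x u) (x v) * s v) * y v) - (∑ v, c v * y v) ^ 2 := by
        calc star y ⬝ᵥ ((cosMatrix Q - vecMulVec c c) *ᵥ y)
            = ∑ u, ∑ v, (y u * (s u * Q (x u) (x v) * s v) * y v - (c u * y u) * (c v * y v)) := by
              simp only [dotProduct, mulVec, star_trivial, Matrix.sub_apply, vecMulVec_apply,
                Finset.mul_sum]
              refine Finset.sum_congr rfl fun u _ => Finset.sum_congr rfl fun v _ => ?_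
              rw [hCuv]
              ring
          _ = (∑ u, ∑ v, y u * (s u * Q (x u) (x v) * s v) * y v) - (∑ v, c v * y v) ^ 2 := by
              simp only [Finset.sum_sub_distrib]
              rw [← Finset.sum_mul_sum, sq]
      rw [hCform, ← hQform]
      exact hz

/-- **The Hadamard–Bessel inequality** (registered stub `stub_hadamardBessel` of the line
`hadamard-bessel-defect`): for nonnegative weights and any certificate pair `Q` for `(G, w)`,
`Q'` for `(Gᶜ, w')` at level `t`, `Σ_v w_v w'_v ≤ λ_max(cosMatrix Q ⊙ cosMatrix Q')`, the bound
`λ_max ≤ M` being expressed as `M • 1 − C ⊙ C' ⪰ 0`. Proof: with the Bessel vectors `c, c'` of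
`IsCertificate.exists_sq_bound_cosMatrix_sub_posSemidef` and `d = c ⊙ c'`,
termwise `w_v w'_v ≤ c_v² c'_v² = d_v²`; Schur-product monotonicity
`C ⊙ C' − d dᵀ = (C − ccᵀ) ⊙ C' + ccᵀ ⊙ (C' − c'c'ᵀ) ⪰ 0` (Mathlib's Schur product theorem
`Matrix.PosSemidef.hadamard`); adding the hypothesis gives `M • 1 − d dᵀ ⪰ 0`, which tested on
`d` yields `‖d‖² (M − ‖d‖²) ≥ 0`, hence `Σ_v w_v w'_v ≤ ‖d‖² ≤ M` (using `0 ≤ M` when `d = 0`).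
The graphs and the `indep` fields play no role. [folklore] -/
theorem stub_hadamardBessel :
    ∀ (n t : ℕ) (G : SimpleGraph (Fin n)) (w w' : Fin n → ℝ)
      (Q Q' : Matrix (Idx (Fin n) t) (Idx (Fin n) t) ℝ) (M : ℝ),
      0 ≤ M → (∀ v, 0 ≤ w v) → (∀ v, 0 ≤ w' v) →
      IsCertificate G t w Q → IsCertificate Gᶜ t w' Q' →
      (M • (1 : Matrix (Fin n) (Fin n) ℝ) - cosMatrix Q ⊙ cosMatrix Q').PosSemidef →
        ∑ v, w v * w' v ≤ M := by
  intro n t G w w' Q Q' M hM _hw hw' hQ hQ' hpsd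
  obtain ⟨c, hc1, hc2⟩ := hQ.exists_sq_bound_cosMatrix_sub_posSemidef
  obtain ⟨c', hc1', hc2'⟩ := hQ'.exists_sq_bound_cosMatrix_sub_posSemidef
  -- rank-one Gram matrices are positive semidefinite, hence so is `cosMatrix Q'`
  have hcc : (vecMulVec c c).PosSemidef := by
    simpa using posSemidef_vecMulVec_self_star c
  have hcc' : (vecMulVec c' c').PosSemidef := by
    simpa using posSemidef_vecMulVec_self_star c'
  have hB : (cosMatrix Q').PosSemidef := by
    simpa using hc2'.add hcc'
  -- Schur-product monotonicity: `C ⊙ C' − d dᵀ ⪰ 0` for `d = c ⊙ c'`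
  obtain ⟨d, hd⟩ : ∃ d : Fin n → ℝ, ∀ v, d v = c v * c' v := ⟨_, fun v => rfl⟩
  have h3 : (cosMatrix Q ⊙ cosMatrix Q' - vecMulVec d d).PosSemidef := by
    have h := (hc2.hadamard hB).add (hcc.hadamard hc2')
    have heq : (cosMatrix Q - vecMulVec c c) ⊙ cosMatrix Q'
          + vecMulVec c c ⊙ (cosMatrix Q' - vecMulVec c' c')
        = cosMatrix Q ⊙ cosMatrix Q' - vecMulVec d d := by
      ext i j
      simp only [hadamard_apply, Matrix.add_apply, Matrix.sub_apply, vecMulVec_apply, hd]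
      ring
    rwa [heq] at h
  -- hence `M • 1 − d dᵀ ⪰ 0`; test it on `d`
  have h4 : (M • (1 : Matrix (Fin n) (Fin n) ℝ) - vecMulVec d d).PosSemidef := by
    have h := hpsd.add h3
    rwa [sub_add_sub_cancel] at h
  have hv : vecMulVec d d *ᵥ d = (d ⬝ᵥ d) • d := by
    ext i
    simp only [mulVec, dotProduct, vecMulVec_apply, Pi.smul_apply, smul_eq_mul, Finset.sum_mul]
    exact Finset.sum_congr rfl fun j _ => by ring
  have h5 : 0 ≤ (d ⬝ᵥ d) * (M - d ⬝ᵥ d) := by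
    have h := h4.dotProduct_mulVec_nonneg d
    rw [star_trivial, sub_mulVec, smul_mulVec, one_mulVec, hv, dotProduct_sub, dotProduct_smul,
      dotProduct_smul, smul_eq_mul, smul_eq_mul] at h
    linarith
  -- termwise `w_v w'_v ≤ d_v²`
  have hsum : ∑ v, w v * w' v ≤ d ⬝ᵥ d := by
    unfold dotProduct
    refine Finset.sum_le_sum fun v _ => ?_
    rw [hd]
    exact (mul_le_mul (hc1 v) (hc1' v) (hw' v) (sq_nonneg _)).trans_eq (by ring)
  by_contra hlt
  rw [not_le] at hlt
  have hpos : 0 < d ⬝ᵥ d := by linarith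
  have h6 := (mul_nonneg_iff_of_pos_left hpos).1 h5
  linarith

end Summit.PneNP.PneNP.Cruxes.SosUncertainty.HadamardBesselDefect
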